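import Summits.HubbardSuperconductivity.HubbardSuperconductivity.Theorems.AnisotropyChordChordXYOfThermalChord
import Summits.HubbardSuperconductivity.HubbardSuperconductivity.Theorems.AnisotropyChordThermalCondensateAnalytic
import Summits.HubbardSuperconductivity.HubbardSuperconductivity.Theorems.AnisotropyChordChordsFromOpenPieces

/-!
# Route `AnisotropyChord`, crux `ChordXY` (stmt-HubbardSuperconductivity-8146) and `ChordFM`
# (stmt-8147): the cruxes from the SIGN OF THE SECOND `Δ`-DERIVATIVE of the canonical sector
# condensate — the end-to-end reduction of line `thermal_af`, BY NAME

`Λ_{β,M}(Δ) = thermalCondensate M β Δ` (canonical `S^z_tot = 0` sector condensate of the XXZ torus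
`H_M(Δ)`), real-analytic in `Δ` (`analyticAt_thermalCondensate`).

* **`chordXY_of_eventually_deriv2_nonpos`** — if for every even `M ≥ 4`, eventually in `β`,
  `(d/dΔ)² Λ_{β,M}(Δ) ≤ 0` on `(-1, 0)`, then the route decl `ChordXY` holds
  (`stub_thermalChordAF_of_eventually_deriv2_nonpos` ∘ `chordXY_of_thermalChordAF`);
  `chordXY_of_eventually_concaveOn` — the same from eventual concavity of `Λ_{β,M}` on `[-1,0]`;
* **`chordFM_of_eventually_deriv2_nonpos_of_ferroSide`** — with `FerroSideChordLarge` (stmt-23918) and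
  `FerroSideChordSmall` (stmt-23919) the same sign statement gives `ChordFM` (`chordFM_of_open_pieces`).

So the AF-side crux of the route is EXACTLY the statement "the canonical half-filled-sector condensate
of the S=½ XXZ torus is concave in the Ising anisotropy on the antiferromagnetic side at low
temperature" (a GHS-type second-order correlation inequality; open — Benassi–Lees–Ueltschi 2016 §1
prove only first-order Ginibre inequalities for two-component quantum models). Pure composition of
landed theorems; no crux closes. [bookkeeping]
-/

set_option linter.dupNamespace false

noncomputable section

namespace Summit.HubbardSuperconductivity.HubbardSuperconductivity.Theorems.AnisotropyChord

open Filter Topology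
open Literature.MathematicalPhysics.QuantumLattice Literature.Probability.LatticeModels
open Summit.HubbardSuperconductivity.HubbardSuperconductivity.Theses.AnisotropyChord

/-- **`ChordXY` from eventual concavity of the canonical sector condensate in `Δ` on `[-1,0]`.**
[bookkeeping] -/
theorem chordXY_of_eventually_concaveOn
    (hconc : ∀ (M : ℕ) [NeZero M], Even M → 4 ≤ M →
      ∀ᶠ β : ℝ in atTop, ConcaveOn ℝ (Set.Icc (-1:ℝ) 0) (fun Δ : ℝ => thermalCondensate M β Δ)) :
    ChordXY :=
  chordXY_of_thermalChordAF (stub_thermalChordAF_of_eventually_concaveOn hconc)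

/-- **`ChordXY` (stmt-HubbardSuperconductivity-8146) from the sign of the second `Δ`-derivative of the
canonical sector condensate**: if for every even `M ≥ 4`, for all large `β`,
`(d/dΔ)² Λ_{β,M}(Δ) ≤ 0` for `Δ ∈ (-1,0)`, then `ChordXY`. This is the route's variance-comparison
engine ("`(log Λ_β)''` is a difference of variances") in its weakest usable form, composed end to end
with the landed skeleton glue. [bookkeeping] -/
theorem chordXY_of_eventually_deriv2_nonpos
    (hsign : ∀ (M : ℕ) [NeZero M], Even M → 4 ≤ M → ∀ᶠ β : ℝ in atTop,
      ∀ Δ ∈ Set.Ioo (-1:ℝ) 0, deriv^[2] (fun Δ : ℝ => thermalCondensate M β Δ) Δ ≤ 0) :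
    ChordXY :=
  chordXY_of_thermalChordAF (stub_thermalChordAF_of_eventually_deriv2_nonpos hsign)

/-- **`ChordFM` (stmt-HubbardSuperconductivity-8147) from the same sign statement and the two open
FM-side pieces** `FerroSideChordLarge` (stmt-23918), `FerroSideChordSmall` (stmt-23919).
[bookkeeping] -/
theorem chordFM_of_eventually_deriv2_nonpos_of_ferroSide
    (hsign : ∀ (M : ℕ) [NeZero M], Even M → 4 ≤ M → ∀ᶠ β : ℝ in atTop,
      ∀ Δ ∈ Set.Ioo (-1:ℝ) 0, deriv^[2] (fun Δ : ℝ => thermalCondensate M β Δ) Δ ≤ 0)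
    (hL : FerroSideChordLarge) (hS : FerroSideChordSmall) : ChordFM :=
  chordFM_of_open_pieces (chordXY_of_eventually_deriv2_nonpos hsign) hL hS

end Summit.HubbardSuperconductivity.HubbardSuperconductivity.Theorems.AnisotropyChord

end
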